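import Summits.AtomisticToContinuum.FouriersLaw.Theses.PuiseuxTransferLedger

/-!
# `PuiseuxTransferLedger.Assembly` — PROVED

Route `AtomisticToContinuum/FouriersLaw/PuiseuxTransferLedger`, assembly item
`stmt-AtomisticToContinuum-12116` (`Assembly`):

  `NessUnique → FiniteResponseOfUnique → PositiveConductance → FiniteResponseProfile →
   ContactIdentity → SeriesLedgerGlue → TwoModeBulk → NonBallistic → FouriersLaw`.

The route file carries the planner-authored, sorry-free D-0027 §2.1 deciding theorem
`Summit.AtomisticToContinuum.FouriersLaw.Theses.PuiseuxTransferLedger.closes`, whose type is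
literally the body of `Assembly`; this file records the item-closing theorem whose type is the
route decl `Assembly` by name.  For the mathematics (clause (i) of `FouriersLawFor` from the in-tree
existence theorem `pinnedChain_exists_isSteadyState` plus weak-NESS uniqueness; clause (ii) along the
canonical family of unique steady states: telescoping the two-mode bulk inequality over the bonds,
a geometric sum uniform in `N`, the exact contact rows, and the series-ledger glue giving `r > 0`
and `D_N → 1/r`; transfer to any steady-state family by uniqueness near `δ = 0`) see the docstring
of `closes` in the route file.  No named-fact hypotheses: the theorem is unconditional (its axioms
are those of `closes`: `propext`, `Classical.choice`, `Quot.sound`).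
-/

namespace Summit.AtomisticToContinuum.FouriersLaw.Theorems

/-- Settles `stmt-AtomisticToContinuum-12116` (assembly of route `PuiseuxTransferLedger`): weak
steady-state uniqueness `NessUnique`, existence of the finite-`N` response coefficients
`FiniteResponseOfUnique`, positivity of the conductance `PositiveConductance`, existence of the
kinetic-temperature response profile `FiniteResponseProfile`, the exact first-order contact rows
`ContactIdentity`, the pure-real-analysis `SeriesLedgerGlue`, and the two cruxes `TwoModeBulk`
(Jordan pair + annular gap of the linearised spatial transfer, read at `ω = 0`) and `NonBallistic`
imply the sub-problem statement `FouriersLaw`.  Proof: the route's deciding theorem `closes`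
(after unfolding `Assembly`). [folklore] -/
theorem puiseuxTransferLedger_assembly_proof :
    Summit.AtomisticToContinuum.FouriersLaw.Theses.PuiseuxTransferLedger.Assembly := by
  unfold Summit.AtomisticToContinuum.FouriersLaw.Theses.PuiseuxTransferLedger.Assembly
  exact Summit.AtomisticToContinuum.FouriersLaw.Theses.PuiseuxTransferLedger.closes

end Summit.AtomisticToContinuum.FouriersLaw.Theorems
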